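import Mathlib
import Literature.Analysis.FluidPDE.Tao2016AveragedNS.SelfSimilarCascadeBlowup
import Literature.Analysis.FluidPDE.Tao2016AveragedNS.ViscousEternalSolutions
import Literature.Analysis.FluidPDE.Tao2016AveragedNS.BoundedEternalSolutions
import Summits.NavierStokesRegularity.NavierStokesRegularity.Theses.TaoLadderRungTwoBreak
import HarnessLib

/-!
# `TaoLadderRungTwoBreak.NoSurvivingEternalViscBddOne` (item stmt-NavierStokesRegularity-20419, K1ᵛ(1),
  DECIDING) — the by-name LINK WEB of the Liouville side in the tree, and the (ρ+) stub read as an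
  EMPTINESS statement

MODEL lattice ODEs only (Tao 2016 §4 in the log-time variables of §6.4; cell vocabulary of
`RenormalisedCascadeWaves` / `SelfSimilarCascadeBlowup` / `ViscousEternalSolutions` /
`BoundedEternalSolutions`); nothing in this file is a statement about the Navier–Stokes equations, and
NO item is closed by it (`--supports stmt-NavierStokesRegularity-20419 --as helper`).

The registered skeleton of K1ᵛ(1) (`NoSurvivingEternalViscBddOne_birth.lean`, sha16 `d325e733a2d7e7e3`)
has two stubs, VERBATIM the route's split children: `stub_noSurvivingEternalBddOne`
(= `NoSurvivingEternalBddOne`, ⟨20451⟩, (ρ0) bounded INVISCID Liouville) and `stub_noLoudLadderOne`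
(= `NoLoudLadderOne`, ⟨20452⟩, (ρ+) loud-ladder exclusion).  What this file records, kernel-checked:

§1 LINKS (previously only in cell packages):
* `noSurvivingEternalBddOne_of_noSurvivingEternalViscBddOne` — the crux gives its child (ρ0) (ν̂ = 0 slice);
* `noLoudLadderOne_of_noSurvivingEternalViscBddOne` — the crux gives its child (ρ+) (drop a hypothesis);
* `noSurvivingEternalViscBddOne_iff_split` — **the glued split is an EQUIVALENCE**:
  `NoSurvivingEternalViscBddOne ↔ NoSurvivingEternalBddOne ∧ NoLoudLadderOne` (⇐ is the tree glue
  `noSurvivingEternalViscBddOne_of`, which consumes the PROVED seeded slice `noSurvivingViscSeededBdd R 4096`);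
* `noSurvivingDSSOne_of_noSurvivingEternalBddOne` / `noSurvivingDSSOne_of_noSurvivingEternalViscBddOne` —
  (ρ0), hence the crux, gives the rev-1 crux `NoSurvivingDSSOne` ⟨20205⟩ BY NAME
  (`noSurvivingDSS_of_noSurvivingEternalBdd`: DSS waves embed as uniformly bounded eternal solutions);
* `stub_noSurvivingEternalBddOne_of_stub_eternalLiouville` — the hard stub `stub_eternalLiouville` of
  ⟨20205⟩'s skeleton (`73b53d2f2a6a7842`; signature quoted VERBATIM as a hypothesis, = `∀ R ≥ 1,
  NoSurvivingEternalFwd R 1`) gives ⟨20419⟩'s stub (ρ0) (drop `UniformBound`): ONE wall serves both cruxes.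

§2 THE (ρ+) STUB IS AN EMPTINESS STATEMENT:
* `eternalSurvivingFwd_one_of_loud` — **a uniformly bounded family that is LOUD ON EVERY SHELL (each
  shell's a=1-weighted energy exceeds every level `< ν̂²/4096` at some log-time) is forward
  (S₁)-surviving** — pure bookkeeping: `wtEnergy n σ ≤ (1+ε₀)^{-4n} e^{2σ} C²`, so loudness at a high
  shell can only happen LATE (`σ ≥ N` once `(1+ε₀)^{4n} ≥ e^{2N} C²/c`); no dynamics used;
* `noLoudLadder_iff_quietShell` — hence `NoLoudLadder R` says: below a threshold EVERY uniformly bounded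
  admissible viscous (`ν̂ > 0`) eternal solution of an E₂(R) table HAS A QUIET (seeded) SHELL — exactly
  the hypothesis of the proved slice; and `noLoudLadder_iff_posHalf` — `NoLoudLadder R` IS the whole
  `ν̂ > 0` half of `NoSurvivingEternalViscBdd R 1`.

HONEST FRAMING: pure logic and one elementary estimate over the tree's predicates; the mathematical
content of K1ᵛ(1) (why bounded eternal solutions of a fixed-spread table cannot keep `(1+ε₀)^n E_n`
from decaying) is not touched; ⟨20419⟩, ⟨20451⟩, ⟨20452⟩, ⟨20205⟩ stay OPEN.
-/

noncomputable section

-- the sub-problem namespace repeats the summit name by design (D-0017)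
set_option linter.dupNamespace false

namespace Summit.NavierStokesRegularity.NavierStokesRegularity.Theorems.NoSurvivingEternalViscBddOne

open Literature.Analysis.FluidPDE Literature.Analysis.FluidPDE.TaoCascade
open Summit.NavierStokesRegularity.NavierStokesRegularity.Theses.TaoLadderRungTwoBreak

/-! ### §1 The link web of the K1 family -/

/-- The crux K1ᵛ(1) gives its split child (ρ0) `NoSurvivingEternalBddOne` (the `ν̂ = 0` slice:
an admissible inviscid eternal solution is an admissible viscous one with `ν̂ = 0`, `IsEternal.isEternalVisc`).
[cite: Tao2016AveragedNS, §4 Thm. 4.2 (statement shape), §6.4; cell vocabulary] -/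
theorem noSurvivingEternalBddOne_of_noSurvivingEternalViscBddOne (h : NoSurvivingEternalViscBddOne) :
    NoSurvivingEternalBddOne := by
  intro R hR
  obtain ⟨εs, hεs, H⟩ := h R hR
  exact ⟨εs, hεs, fun ε₀ hε₀ hle α hα W hW hU => H ε₀ hε₀ hle α hα 0 W hW.isEternalVisc hU⟩

/-- The crux K1ᵛ(1) gives its split child (ρ+) `NoLoudLadderOne` (forget the loudness hypothesis).
[cite: Tao2016AveragedNS, §4 Thm. 4.2 (statement shape), §6.4; cell vocabulary] -/
theorem noLoudLadderOne_of_noSurvivingEternalViscBddOne (h : NoSurvivingEternalViscBddOne) :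
    NoLoudLadderOne := by
  intro R hR
  obtain ⟨εs, hεs, H⟩ := h R hR
  exact ⟨εs, hεs, fun ε₀ hε₀ hle α hα νh W _ hW hU _ => H ε₀ hε₀ hle α hα νh W hW hU⟩

/-- **The glued split of K1ᵛ(1) is an equivalence**: `NoSurvivingEternalViscBddOne ↔
NoSurvivingEternalBddOne ∧ NoLoudLadderOne` (⇐: the tree glue `noSurvivingEternalViscBddOne_of`, case split
`ν̂ = 0` / seeded shell (PROVED slice `noSurvivingViscSeededBdd R 4096`) / loud ladder).
[cite: Tao2016AveragedNS, §4 Thm. 4.2 (statement shape), §6.4; cell vocabulary] -/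
theorem noSurvivingEternalViscBddOne_iff_split :
    NoSurvivingEternalViscBddOne ↔ NoSurvivingEternalBddOne ∧ NoLoudLadderOne :=
  ⟨fun h => ⟨noSurvivingEternalBddOne_of_noSurvivingEternalViscBddOne h,
    noLoudLadderOne_of_noSurvivingEternalViscBddOne h⟩,
    fun h R hR => noSurvivingEternalViscBddOne_of (h.1 R hR) (h.2 R hR)⟩

/-- (ρ0) gives the rev-1 crux K1(1) `NoSurvivingDSSOne` ⟨stmt-NavierStokesRegularity-20205⟩ BY NAME: a surviving
admissible DSS wave embeds as a uniformly bounded, forward-surviving admissible eternal solution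
(`noSurvivingDSS_of_noSurvivingEternalBdd`; `NoSurvivingDSSOne` is `∀ R ≥ 1, NoSurvivingDSS R 1` by `rfl`).
[cite: Tao2016AveragedNS, §4 (4.1)–(4.4), §6.4; cell vocabulary] -/
theorem noSurvivingDSSOne_of_noSurvivingEternalBddOne (h : NoSurvivingEternalBddOne) : NoSurvivingDSSOne :=
  fun R hR => noSurvivingDSS_of_noSurvivingEternalBdd (h R hR)

/-- The DECIDING crux K1ᵛ(1) ⟨20419⟩ gives the rev-1 crux K1(1) ⟨20205⟩ BY NAME.
[cite: Tao2016AveragedNS, §4 (4.1)–(4.4), §6.4; cell vocabulary] -/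
theorem noSurvivingDSSOne_of_noSurvivingEternalViscBddOne (h : NoSurvivingEternalViscBddOne) :
    NoSurvivingDSSOne :=
  noSurvivingDSSOne_of_noSurvivingEternalBddOne (noSurvivingEternalBddOne_of_noSurvivingEternalViscBddOne h)

/-- The hard stub `stub_eternalLiouville` of ⟨20205⟩'s registered skeleton (`73b53d2f2a6a7842`) is LITERALLY
`∀ R ≥ 1, NoSurvivingEternalFwd R 1` (K1^∞_fwd(·,1)).
[cite: Tao2016AveragedNS, §4 Thm. 4.2 (statement shape); cell vocabulary] -/
theorem stubEternalLiouville_iff :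
    (∀ R : ℝ, 1 ≤ R → ∃ εs : ℝ, 0 < εs ∧ ∀ ε₀ : ℝ, 0 < ε₀ → ε₀ ≤ εs →
      ∀ α : (Fin 4 → Fin 4 → Fin 4 → ℤ × ℤ × ℤ → ℝ), InTableClass R α →
        ∀ W : ℤ → ℝ → Em 4, IsEternal ε₀ α W → ¬ EternalSurvivingFwd 1 ε₀ W) ↔
    ∀ R : ℝ, 1 ≤ R → NoSurvivingEternalFwd R 1 :=
  Iff.rfl

/-- **One wall serves both cruxes**: the hard stub `stub_eternalLiouville` of ⟨20205⟩ (signature VERBATIM as the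
hypothesis) gives the stub (ρ0) `stub_noSurvivingEternalBddOne` of ⟨20419⟩ = the child `NoSurvivingEternalBddOne`
⟨20451⟩ (forget `UniformBound`; tree `noSurvivingEternalBdd_of_fwd`).
[cite: Tao2016AveragedNS, §4 Thm. 4.2 (statement shape); cell vocabulary] -/
theorem stub_noSurvivingEternalBddOne_of_stub_eternalLiouville
    (h : ∀ R : ℝ, 1 ≤ R → ∃ εs : ℝ, 0 < εs ∧ ∀ ε₀ : ℝ, 0 < ε₀ → ε₀ ≤ εs →
      ∀ α : (Fin 4 → Fin 4 → Fin 4 → ℤ × ℤ × ℤ → ℝ), InTableClass R α →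
        ∀ W : ℤ → ℝ → Em 4, IsEternal ε₀ α W → ¬ EternalSurvivingFwd 1 ε₀ W) :
    ∀ R : ℝ, 1 ≤ R → NoSurvivingEternalBdd R 1 :=
  fun R hR => noSurvivingEternalBdd_of_fwd (h R hR)

/-- … and together with (ρ+) it gives the DECIDING crux K1ᵛ(1) itself.
[cite: Tao2016AveragedNS, §4 Thm. 4.2 (statement shape); cell vocabulary] -/
theorem noSurvivingEternalViscBddOne_of_stub_eternalLiouville_of_noLoudLadderOne
    (h : ∀ R : ℝ, 1 ≤ R → ∃ εs : ℝ, 0 < εs ∧ ∀ ε₀ : ℝ, 0 < ε₀ → ε₀ ≤ εs →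
      ∀ α : (Fin 4 → Fin 4 → Fin 4 → ℤ × ℤ × ℤ → ℝ), InTableClass R α →
        ∀ W : ℤ → ℝ → Em 4, IsEternal ε₀ α W → ¬ EternalSurvivingFwd 1 ε₀ W)
    (hL : NoLoudLadderOne) : NoSurvivingEternalViscBddOne :=
  noSurvivingEternalViscBddOne_iff_split.2 ⟨stub_noSurvivingEternalBddOne_of_stub_eternalLiouville h, hL⟩

/-! ### §2 Loud on every shell ⇒ surviving; the (ρ+) stub as an emptiness statement -/

/-- The a=1 weight: `physWeight 1 ε₀ = ((1+ε₀)^4)⁻¹`.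
[cite: Tao2016AveragedNS, §4 (4.1), §6.4; cell vocabulary] -/
theorem physWeight_one_eq {ε₀ : ℝ} (hε : 0 < ε₀) : physWeight 1 ε₀ = ((1 + ε₀) ^ (4 : ℕ))⁻¹ := by
  have hb : (0 : ℝ) < 1 + ε₀ := by linarith
  unfold physWeight
  rw [Real.rpow_one]
  field_simp

/-- Under a uniform bound `‖W_k(σ)‖ ≤ C` the a=1-weighted energy of shell `n` at log-time `σ` is at most
`((1+ε₀)^4)^{-n} · e^{2σ} · C²`.
[cite: Tao2016AveragedNS, §4 Lemma 4.1 (4.8), §6.4; cell vocabulary] -/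
theorem wtEnergy_le_of_uniformBound {ε₀ C : ℝ} (hε : 0 < ε₀) {W : ℤ → ℝ → Em 4}
    (hC : ∀ (k : ℤ) (σ : ℝ), ‖W k σ‖ ≤ C) (n : ℕ) (σ : ℝ) :
    wtEnergy ε₀ W n σ ≤ (((1 + ε₀) ^ (4 : ℕ))⁻¹) ^ n * (Real.exp (2 * σ) * C ^ 2) := by
  have hC0 : 0 ≤ C := (norm_nonneg _).trans (hC 0 0)
  unfold wtEnergy
  rw [physWeight_one_eq hε]
  have h1 : ‖W n σ‖ ^ 2 ≤ C ^ 2 := pow_le_pow_left₀ (norm_nonneg _) (hC n σ) 2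
  have hw : 0 ≤ (((1 + ε₀) ^ (4 : ℕ))⁻¹ : ℝ) ^ n := by positivity
  exact mul_le_mul_of_nonneg_left (mul_le_mul_of_nonneg_left h1 (Real.exp_pos _).le) hw

/-- **Loud on every shell ⇒ forward (S₁)-surviving** (no dynamics).  If `‖W_k(σ)‖ ≤ C` uniformly and every
shell `n` carries a=1-weighted energy above every level `< ν̂²/4096` at SOME log-time, then `W` is forward
(S₁)-surviving at the level `ν̂²/8192`: loudness at shell `n` forces the log-time to be late,
`e^{2σ} ≥ c (1+ε₀)^{4n}/C²`.
[cite: Tao2016AveragedNS, §4 Lemma 4.1 (4.8), §6.4 (self-similar variables); cell vocabulary (`wtEnergy`, `EternalSurvivingFwd`)] -/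
theorem eternalSurvivingFwd_one_of_loud {ε₀ νh : ℝ} (hε : 0 < ε₀) (hν : 0 < νh) {W : ℤ → ℝ → Em 4}
    (hU : UniformBound W)
    (hloud : ∀ n₀ : ℕ, ∀ s₀ : ℝ, s₀ < νh ^ 2 / 4096 → ∃ σ : ℝ, s₀ < wtEnergy ε₀ W n₀ σ) :
    EternalSurvivingFwd 1 ε₀ W := by
  obtain ⟨C, hC⟩ := hU
  have hC0 : 0 ≤ C := (norm_nonneg _).trans (hC 0 0)
  set c : ℝ := νh ^ 2 / 8192 with hc
  have hcpos : 0 < c := by positivity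
  have hclt : c < νh ^ 2 / 4096 := by
    rw [hc]; rw [div_lt_div_iff_of_pos_left (by positivity) (by norm_num) (by norm_num)]; norm_num
  refine ⟨c, hcpos, fun N => ?_⟩
  -- the base `(1+ε₀)^4 > 1`: its powers dominate `e^{2N} C² / c`
  have hb : (1 : ℝ) < (1 + ε₀) ^ (4 : ℕ) := one_lt_pow₀ (by linarith) (by norm_num)
  obtain ⟨n₁, hn₁⟩ := pow_unbounded_of_one_lt (Real.exp (2 * N) * C ^ 2 / c) hb
  set n : ℕ := max N n₁ with hn
  have hNn : N ≤ n := le_max_left _ _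
  have hpow : Real.exp (2 * N) * C ^ 2 / c < ((1 + ε₀) ^ (4 : ℕ)) ^ n :=
    lt_of_lt_of_le hn₁ (pow_le_pow_right₀ hb.le (le_max_right _ _))
  obtain ⟨σ, hσ⟩ := hloud n c hclt
  refine ⟨n, hNn, σ, ?_, ?_⟩
  · -- the log-time is late: otherwise the weighted energy would be below `c`
    by_contra hlt
    push Not at hlt
    have hq : 0 < ((1 + ε₀) ^ (4 : ℕ)) ^ n := by positivity
    have h1 := wtEnergy_le_of_uniformBound hε hC n σ
    have h2 : Real.exp (2 * σ) ≤ Real.exp (2 * N) := Real.exp_le_exp.2 (by linarith)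
    have h3 : wtEnergy ε₀ W n σ ≤ (((1 + ε₀) ^ (4 : ℕ))⁻¹) ^ n * (Real.exp (2 * N) * C ^ 2) :=
      h1.trans (mul_le_mul_of_nonneg_left (mul_le_mul_of_nonneg_right h2 (sq_nonneg _))
        (by positivity))
    have h4 : (((1 + ε₀) ^ (4 : ℕ))⁻¹) ^ n * (Real.exp (2 * N) * C ^ 2) < c := by
      rw [inv_pow, inv_mul_lt_iff₀ hq]
      exact (div_lt_iff₀ hcpos).1 hpow
    linarith
  · exact hσ.le

/-- **`NoLoudLadder R` as an emptiness statement**: below a threshold, EVERY uniformly bounded admissible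
viscous (`ν̂ > 0`) eternal solution of an E₂(R) table has a QUIET (seeded) shell — some shell whose
a=1-weighted energy stays below a level `< ν̂²/4096` at all log-times (the hypothesis of the PROVED slice
`noSurvivingViscSeededBdd R 4096`).  (⇒: a loud ladder would be surviving by `eternalSurvivingFwd_one_of_loud`;
⇐: a loud ladder has no quiet shell.)
[cite: Tao2016AveragedNS, §4 Thm. 4.2 (statement shape), Lemma 4.1 (4.8), §6.4; cell vocabulary] -/
theorem noLoudLadder_iff_quietShell (R : ℝ) :
    NoLoudLadder R ↔
      ∃ εs : ℝ, 0 < εs ∧ ∀ ε₀ : ℝ, 0 < ε₀ → ε₀ ≤ εs →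
        ∀ α : Fin 4 → Fin 4 → Fin 4 → ℤ × ℤ × ℤ → ℝ, InTableClass R α →
          ∀ (νh : ℝ) (W : ℤ → ℝ → Em 4), 0 < νh → IsEternalVisc ε₀ νh α W → UniformBound W →
            ∃ n₀ : ℕ, ∃ s₀ : ℝ, s₀ < νh ^ 2 / 4096 ∧ ∀ σ : ℝ, wtEnergy ε₀ W n₀ σ ≤ s₀ := by
  constructor
  · rintro ⟨εs, hεs, H⟩
    refine ⟨εs, hεs, fun ε₀ hε₀ hle α hα νh W hν hW hU => ?_⟩
    by_contra hno
    push Not at hno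
    have hloud : ∀ n₀ : ℕ, ∀ s₀ : ℝ, s₀ < νh ^ 2 / 4096 → ∃ σ : ℝ, s₀ < wtEnergy ε₀ W n₀ σ :=
      fun n₀ s₀ hs₀ => hno n₀ s₀ hs₀
    exact H ε₀ hε₀ hle α hα νh W hν hW hU hloud (eternalSurvivingFwd_one_of_loud hε₀ hν hU hloud)
  · rintro ⟨εs, hεs, H⟩
    refine ⟨εs, hεs, fun ε₀ hε₀ hle α hα νh W hν hW hU hloud _ => ?_⟩
    obtain ⟨n₀, s₀, hs₀, hquiet⟩ := H ε₀ hε₀ hle α hα νh W hν hW hU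
    obtain ⟨σ, hσ⟩ := hloud n₀ s₀ hs₀
    exact absurd (hquiet σ) (not_le.2 hσ)

/-- **`NoLoudLadder R` IS the whole `ν̂ > 0` half of `NoSurvivingEternalViscBdd R 1`**: below a threshold, no
uniformly bounded admissible viscous eternal solution with `ν̂ > 0` of an E₂(R) table is forward
(S₁)-surviving (⇒: quiet shell + the PROVED seeded slice `noSurvivingViscSeededBdd R 4096`, thresholds by
`min`; ⇐: forget the loudness hypothesis).
[cite: Tao2016AveragedNS, §4 Thm. 4.2 (statement shape), Lemma 4.1 (4.8), §6.4; cell vocabulary] -/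
theorem noLoudLadder_iff_posHalf (R : ℝ) :
    NoLoudLadder R ↔
      ∃ εs : ℝ, 0 < εs ∧ ∀ ε₀ : ℝ, 0 < ε₀ → ε₀ ≤ εs →
        ∀ α : Fin 4 → Fin 4 → Fin 4 → ℤ × ℤ × ℤ → ℝ, InTableClass R α →
          ∀ (νh : ℝ) (W : ℤ → ℝ → Em 4), 0 < νh → IsEternalVisc ε₀ νh α W → UniformBound W →
            ¬ EternalSurvivingFwd 1 ε₀ W := by
  constructor
  · intro h
    obtain ⟨ε₁, hε₁, H⟩ := (noLoudLadder_iff_quietShell R).1 h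
    obtain ⟨ε₃, hε₃, HS⟩ := noSurvivingViscSeededBdd R
    refine ⟨min ε₁ ε₃, lt_min hε₁ hε₃, fun ε₀ hε₀ hle α hα νh W hν hW hU => ?_⟩
    obtain ⟨n₀, s₀, hs₀, hquiet⟩ := H ε₀ hε₀ (hle.trans (min_le_left _ _)) α hα νh W hν hW hU
    exact HS ε₀ hε₀ (hle.trans (min_le_right _ _)) α hα νh W hν hW n₀
      (typeIBound_of_uniformBound hU n₀) ⟨s₀, hs₀, hquiet⟩
  · rintro ⟨εs, hεs, H⟩
    exact ⟨εs, hεs, fun ε₀ hε₀ hle α hα νh W hν hW hU _ => H ε₀ hε₀ hle α hα νh W hν hW hU⟩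

/-- The split child (ρ+) `NoLoudLadderOne` ⟨20452⟩ (= the stub `stub_noLoudLadderOne` of ⟨20419⟩'s skeleton),
read through `noLoudLadder_iff_posHalf`: for every spread, below a threshold, NO uniformly bounded admissible
viscous (`ν̂ > 0`) eternal solution of an E₂(R) table is forward (S₁)-surviving.
[cite: Tao2016AveragedNS, §4 Thm. 4.2 (statement shape), §6.4; cell vocabulary] -/
theorem noLoudLadderOne_iff_posHalf :
    NoLoudLadderOne ↔ ∀ R : ℝ, 1 ≤ R →
      ∃ εs : ℝ, 0 < εs ∧ ∀ ε₀ : ℝ, 0 < ε₀ → ε₀ ≤ εs →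
        ∀ α : Fin 4 → Fin 4 → Fin 4 → ℤ × ℤ × ℤ → ℝ, InTableClass R α →
          ∀ (νh : ℝ) (W : ℤ → ℝ → Em 4), 0 < νh → IsEternalVisc ε₀ νh α W → UniformBound W →
            ¬ EternalSurvivingFwd 1 ε₀ W :=
  ⟨fun h R hR => (noLoudLadder_iff_posHalf R).1 (h R hR),
    fun h R hR => (noLoudLadder_iff_posHalf R).2 (h R hR)⟩

end Summit.NavierStokesRegularity.NavierStokesRegularity.Theorems.NoSurvivingEternalViscBddOne

end
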